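/-
Origin: expansion seat `planner-pub-hodgecm-toy2-g5-0`, handover #15 2026-08-18T10:14:00Z (`HOME/pub-hodgecm-toy2-g5/lean/Toy2g5/HodgeF0CM.lean`, md5 86bbec82, 167 lines);
landed by the gen-7 packager in gate run 28 as `HodgeCM/Proofs/Pohlmann/HodgeF0CM.lean` (stripped 5 #print/#check/#eval lines).
-/
/-
Copyright (c) 2026. All rights reserved.
Released under Apache 2.0 license as described in the file LICENSE.
Origin: CONSISTENCY seat 2 (6a)(ii) `planner-pub-hodgecm-toy2-g5-0` (unit pub-hodgecm-toy2-g5), handover #15 (RUN 28).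
WIP module `Toy2g5.HodgeF0CM`; intended final place `HodgeCM/Proofs/Pohlmann/HodgeF0CM.lean`
(module `HodgeCM.Proofs.Pohlmann.HodgeF0CM`).  ADDITIVE LEAF over the RUN-27 tree files `HodgeCM.Proofs.Pohlmann.PohlmannAllNoN4`
(qw8b-g5) and `HodgeCM.Proofs.Pohlmann.PohlmannNoN4` (toy2-g5); NO import to rewrite; replaces nothing; nothing imports it.
-/
import Summits.HodgeConjecture.HodgeCM.Proofs.Pohlmann.PohlmannAllNoN4
import Summits.HodgeConjecture.HodgeCM.Proofs.Pohlmann.PohlmannNoN4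

/-!
# N4 restricted to CM abelian varieties is a THEOREM of `ModelAxioms` + N1 + N2 + N3 + connectedness

The complement to the separating model `toyModel♭ᴶ` (`HodgeCM.Model.Toy.ToyPadH0J`: N4 `Fact_hodge_F0` is independent of
`ModelAxioms ∧ N1 ∧ N2 ∧ N3 ∧ …`, failing there exactly on `H⁰` of rank `3`): WHERE the content of N4 sits.

* `hodge_F_zero_cmProd_of_pos` — on the CM products `A′ = ∏_j A_{(F,Θ_j)}` and in every degree `k ≥ 1`, `F⁰ H^k(A′, ℂ) = H^k(A′, ℂ)`
  follows from `ModelAxioms` + N1 + N2 + N3 alone: `H^k = ⨆_S V_S` (M29, `weightSpan_of_facts`, N1 + N3) and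
  `V_S ⊆ H^{p(S), q(S)} ⊆ F^{p(S)} ⊆ F⁰` with `p(S) = Σ_j Σ_{s ∈ S_j} 1_{Θ_j}(s) ≥ 0` (M30 in positive degree,
  `weightHodgeAt_of_facts_of_pos`, N1 + N2);
* `hodge_F_zero_cmProd_of_connected` — in degree `0` it is `dim_ℚ H⁰(A′) = 1` (`hodge_F_zero_H0_cmProd_of_connected`, qw8b-g5);
* `hodge_F_zero_of_isCMAbelianVariety` — by M14 `Fact_cmDominated` (`(π ∘ s)^* = N^k` on `H^k(X)`, `N ≠ 0`) and M7 `Fact_pull_hodge`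
  it transfers to EVERY CM abelian variety `X`: `F⁰ H^k(X, ℂ) = H^k(X, ℂ)` for all `k`, from
  `ModelAxioms ∧ N1 ∧ N2 ∧ N3 ∧ CMProdConnected` — hence from `… ∧ M42 Fact_H0_rank` or `… ∧ M43 Fact_unitH0`
  (`hodge_F_zero_of_isCMAbelianVariety_of_H0_rank`, `…_of_unitH0`).

So, given connectedness of the CM products, the only content of N4 = M34 left is on objects of `U.Var` that are NOT CM abelian
varieties (which M14 does not dominate) — the objects `HC_CM` never mentions.

§2 does the same for N3 `Fact_pull_H0` (separating model `toyModel♭²`, `HodgeCM.Model.Toy.ToyPadH0Two`): restricted to CM abelian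
varieties, N3 is a THEOREM of `ModelAxioms ∧ M43 Fact_unitH0` — on CM products this is qw8b-g3's `pull_H0_cmProd_of_unitH0`
(`UnitH0Connected`: `H⁰(A′) = ℚ·1`, `f^* 1 = 1`); here `coh_zero_eq_smul_one_of_isCMAbelianVariety` (M14 in degree `0`: `x = s^* π^* x ∈ s^*(ℚ·1) = ℚ·1`),
`fact_pull_H0_CM_of_unitH0 : ModelAxioms → Fact_unitH0 → Fact_pull_H0_CM`.  Nothing is cited; Lean + Mathlib axioms only.
-/

noncomputable section

open scoped TensorProduct

namespace HodgeCM

namespace Universe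

open Literature.AlgebraicGeometry.Motives (CMType HodgeStructure)

variable {U : Universe}

/-- (Ported verbatim from the HodgeCMPerL package; no docstring in the source.) -/
theorem ind_nonneg {K : Type} [Field K] (Φ : CMType K) (φ : K →+* ℂ) : 0 ≤ ind Φ φ := by
  unfold ind
  split_ifs <;> decide

/-- **N4 on CM products in positive degree** from `ModelAxioms` + N1 + N2 + N3: `F⁰ H^k(A′, ℂ) = H^k(A′, ℂ)` for `k ≥ 1`. -/
theorem hodge_F_zero_cmProd_of_pos (M : U.ModelAxioms) (hN1 : U.Fact_cupExterior) (hN2 : U.Fact_cup_hodge)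
    (hN3 : U.Fact_pull_H0) (F : CMField) (n : ℕ) (Θ : Fin (n + 1) → CMType F) {k : ℕ} (hk : 0 < k) :
    (U.hodge (U.cmProd F Θ) k).F 0 = ⊤ := by
  rw [eq_top_iff, ← weightSpan_of_facts M hN1 hN3 F n Θ k, iSup_le_iff]
  intro S
  refine le_trans (weightHodgeAt_of_facts_of_pos M hN1 hN2 hk F n Θ S)
    (le_trans (HodgeStructure.piece_le_F _ _ _) ((U.hodge (U.cmProd F Θ) k).antitone_F ?_))
  exact Finset.sum_nonneg fun j _ => Finset.sum_nonneg fun s _ => ind_nonneg (Θ j) s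

/-- **N4 on CM products in every degree** from `ModelAxioms` + N1 + N2 + N3 + `CMProdConnected`. -/
theorem hodge_F_zero_cmProd_of_connected (M : U.ModelAxioms) (hN1 : U.Fact_cupExterior) (hN2 : U.Fact_cup_hodge)
    (hN3 : U.Fact_pull_H0) (h0 : U.CMProdConnected) (F : CMField) (n : ℕ) (Θ : Fin (n + 1) → CMType F) (k : ℕ) :
    (U.hodge (U.cmProd F Θ) k).F 0 = ⊤ := by
  rcases Nat.eq_zero_or_pos k with rfl | hk
  · exact hodge_F_zero_H0_cmProd_of_connected h0 F n Θ
  · exact hodge_F_zero_cmProd_of_pos M hN1 hN2 hN3 F n Θ hk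

/-- The complexified pullback along a dominating pair: `s^* (π^* x) = N^k · x` on `H^k(X, ℂ)`. -/
theorem pullC_pullC_of_dominated {X Y : U.Var} (M : U.ModelAxioms) (s : U.Mor X Y) (π : U.Mor Y X) {N : ℕ} {k : ℕ}
    (h : U.pull (U.comp s π) k = ((N : ℚ) ^ k) • LinearMap.id) (x : U.CohC X k) :
    U.pullC s k (U.pullC π k x) = ((N : ℂ) ^ k) • x := by
  have h1 : U.pullC s k ∘ₗ U.pullC π k = ((N : ℚ) ^ k) • LinearMap.id := by
    show (U.pull s k).baseChange ℂ ∘ₗ (U.pull π k).baseChange ℂ = _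
    rw [← LinearMap.baseChange_comp, ← M.pull_comp, h, LinearMap.baseChange_smul, LinearMap.baseChange_id]
  have h2 := LinearMap.congr_fun h1 x
  rw [LinearMap.comp_apply] at h2
  rw [h2, LinearMap.smul_apply, LinearMap.id_apply, ← algebraMap_smul ℂ ((N : ℚ) ^ k) x, map_pow, map_natCast]

/-- **N4 on every CM abelian variety, in every degree**, from `ModelAxioms` + N1 + N2 + N3 + `CMProdConnected` (transfer along
M14 `Fact_cmDominated` with M7 `Fact_pull_hodge`). -/
theorem hodge_F_zero_of_isCMAbelianVariety (M : U.ModelAxioms) (hN1 : U.Fact_cupExterior) (hN2 : U.Fact_cup_hodge)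
    (hN3 : U.Fact_pull_H0) (h0 : U.CMProdConnected) (X : U.Var) (hX : U.IsCMAbelianVariety X) (k : ℕ) :
    (U.hodge X k).F 0 = ⊤ := by
  obtain ⟨F, -, -, n, Θ, s, π, N, hN, h⟩ := M.cmDominated X hX
  rw [eq_top_iff]
  intro x _
  have hmem : U.pullC s k (U.pullC π k x) ∈ (U.hodge X k).F 0 :=
    M.pull_hodge X (U.cmProd F Θ) s k 0
      ⟨U.pullC π k x, by rw [hodge_F_zero_cmProd_of_connected M hN1 hN2 hN3 h0 F n Θ k]; exact Submodule.mem_top, rfl⟩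
  rw [pullC_pullC_of_dominated M s π (h k)] at hmem
  exact (Submodule.smul_mem_iff _ (pow_ne_zero k (Nat.cast_ne_zero.2 hN))).1 hmem

/-- … hence from `ModelAxioms` + N1 + N2 + N3 + M42 `Fact_H0_rank`. -/
theorem hodge_F_zero_of_isCMAbelianVariety_of_H0_rank (M : U.ModelAxioms) (hN1 : U.Fact_cupExterior)
    (hN2 : U.Fact_cup_hodge) (hN3 : U.Fact_pull_H0) (h42 : U.Fact_H0_rank) (X : U.Var) (hX : U.IsCMAbelianVariety X)
    (k : ℕ) : (U.hodge X k).F 0 = ⊤ :=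
  hodge_F_zero_of_isCMAbelianVariety M hN1 hN2 hN3 (cmProdConnected_of_H0_rank h42) X hX k

/-- … and from `ModelAxioms` + N1 + N2 + N3 + M43 `Fact_unitH0`. -/
theorem hodge_F_zero_of_isCMAbelianVariety_of_unitH0 (M : U.ModelAxioms) (hN1 : U.Fact_cupExterior)
    (hN2 : U.Fact_cup_hodge) (hN3 : U.Fact_pull_H0) (hu : U.Fact_unitH0) (X : U.Var) (hX : U.IsCMAbelianVariety X)
    (k : ℕ) : (U.hodge X k).F 0 = ⊤ :=
  hodge_F_zero_of_isCMAbelianVariety M hN1 hN2 hN3 (cmProdConnected_of_unitH0 M hu) X hX k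

/-- **N4 restricted to CM abelian varieties** as a named statement (the part of N4 that concerns the objects of `HC_CM`). -/
def Fact_hodge_F0_CM (U : Universe) : Prop := ∀ X : U.Var, U.IsCMAbelianVariety X → ∀ k : ℕ, (U.hodge X k).F 0 = ⊤

/-- (Ported verbatim from the HodgeCMPerL package; no docstring in the source.) -/
theorem fact_hodge_F0_CM_of_hodge_F0 (h : U.Fact_hodge_F0) : U.Fact_hodge_F0_CM := fun X _ k => h X k

/-- **`Fact_hodge_F0_CM` is a theorem of `ModelAxioms ∧ N1 ∧ N2 ∧ N3 ∧ CMProdConnected`.** -/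
theorem fact_hodge_F0_CM_of_connected (M : U.ModelAxioms) (hN1 : U.Fact_cupExterior) (hN2 : U.Fact_cup_hodge)
    (hN3 : U.Fact_pull_H0) (h0 : U.CMProdConnected) : U.Fact_hodge_F0_CM :=
  fun X hX k => hodge_F_zero_of_isCMAbelianVariety M hN1 hN2 hN3 h0 X hX k

/-- (Ported verbatim from the HodgeCMPerL package; no docstring in the source.) -/
theorem fact_hodge_F0_CM_of_H0_rank (M : U.ModelAxioms) (hN1 : U.Fact_cupExterior) (hN2 : U.Fact_cup_hodge)
    (hN3 : U.Fact_pull_H0) (h42 : U.Fact_H0_rank) : U.Fact_hodge_F0_CM :=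
  fact_hodge_F0_CM_of_connected M hN1 hN2 hN3 (cmProdConnected_of_H0_rank h42)

/-! ## §2  N3 restricted to CM abelian varieties is a theorem of `ModelAxioms ∧ M43` -/

-- On CM products N3 from M43 alone is qw8b-g3's `pull_H0_cmProd_of_unitH0` (`HodgeCM.Proofs.Pohlmann.UnitH0Connected`, in scope).

/-- `H⁰` of a CM abelian variety is spanned by the unit class (M14 in degree `0` + the M43 data). -/
theorem coh_zero_eq_smul_one_of_isCMAbelianVariety (M : U.ModelAxioms) {one : ∀ X : U.Var, U.Coh X 0}
    (hpull : ∀ (X Y : U.Var) (f : U.Mor X Y), U.pull f 0 (one Y) = one X)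
    (hspan : ∀ (F : CMField) (n : ℕ) (Θ : Fin (n + 1) → CMType F) (e : U.Coh (U.cmProd F Θ) 0),
      ∃ r : ℚ, e = r • one (U.cmProd F Θ))
    (X : U.Var) (hX : U.IsCMAbelianVariety X) (x : U.Coh X 0) : ∃ r : ℚ, x = r • one X := by
  obtain ⟨F, -, -, n, Θ, s, π, N, -, h⟩ := M.cmDominated X hX
  have hx : U.pull s 0 (U.pull π 0 x) = x := by
    have := LinearMap.congr_fun (h 0) x
    rw [M.pull_comp, pow_zero, one_smul, LinearMap.comp_apply, LinearMap.id_apply] at this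
    exact this
  obtain ⟨r, hr⟩ := hspan F n Θ (U.pull π 0 x)
  exact ⟨r, by rw [← hx, hr, map_smul, hpull]⟩

/-- **N3 on every CM abelian variety** from `ModelAxioms ∧ M43 Fact_unitH0`. -/
theorem pull_H0_of_isCMAbelianVariety_of_unitH0 (M : U.ModelAxioms) (hu : U.Fact_unitH0) (X : U.Var)
    (hX : U.IsCMAbelianVariety X) (f : U.Mor X X) : U.pull f 0 = LinearMap.id := by
  obtain ⟨one, hpull, -, hspan⟩ := hu
  ext x
  obtain ⟨r, rfl⟩ := coh_zero_eq_smul_one_of_isCMAbelianVariety M hpull hspan X hX x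
  rw [map_smul, hpull, LinearMap.id_apply]

/-- **N3 restricted to CM abelian varieties** as a named statement. -/
def Fact_pull_H0_CM (U : Universe) : Prop := ∀ X : U.Var, U.IsCMAbelianVariety X → ∀ f : U.Mor X X, U.pull f 0 = LinearMap.id

/-- (Ported verbatim from the HodgeCMPerL package; no docstring in the source.) -/
theorem fact_pull_H0_CM_of_pull_H0 (h : U.Fact_pull_H0) : U.Fact_pull_H0_CM := fun X _ f => h X f

/-- **`Fact_pull_H0_CM` is a theorem of `ModelAxioms ∧ M43`.** -/
theorem fact_pull_H0_CM_of_unitH0 (M : U.ModelAxioms) (hu : U.Fact_unitH0) : U.Fact_pull_H0_CM :=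
  fun X hX f => pull_H0_of_isCMAbelianVariety_of_unitH0 M hu X hX f

end Universe

end HodgeCM

end

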